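import Mathlib
import Summits.NavierStokesRegularity.NavierStokesRegularity.Theorems.FilamentSkeletonRssSkeletonEquilibriumLengthRegularSlow

/-!
# Ends of equilibrium filaments have an asymptotic LATITUDE (SC-free)
(helper for crux `FilamentSkeletonRss.SkeletonEquilibrium`, stmt-NavierStokesRegularity-15400: outer geometry of
proper ends for the registered stubs `stub_lengthRegular` / `stub_outerShadowing`; builds on `…LengthRegularRadial`,
`…LengthRegularSlow` and complements `…EndConeLaw`)

Pairing the tangency relation `u + ½Ξ − α e₃×Ξ = w T` with `Ξ` and with `e₃` and eliminating the slip gives the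
exact, slip-free LATITUDE IDENTITY `‖Ξ‖²⟪T,e₃⟫ − ⟪Ξ,e₃⟫⟪T,Ξ⟫ = 2(⟪u,e₃⟫⟪T,Ξ⟫ − ⟪u,Ξ⟫⟪T,e₃⟫)`
(`latitude_identity`), i.e. the latitude `λ = ⟪Ξ, e₃⟫/‖Ξ‖` (cosine of the polar angle of the POSITION) moves at
rate `|λ′| ≤ 4U/‖Ξ‖²` under `‖u‖ ≤ U` (`abs_deriv_latitude_le`). On an outer branch `‖Ξ‖` grows at rate
`≥ (3+4|α|)⁻¹` (`…LengthRegularRadial`), so `λ ± 4U(3+4|α|)/‖Ξ‖` are monotone there (`latitude_upper_antitone`,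
`latitude_lower_monotone`), whence the Cauchy estimate `|λ(τ₂) − λ(τ₁)| ≤ 4U(3+4|α|)(1/‖Ξ τ₁‖ − 1/‖Ξ τ₂‖)`
(`latitude_cauchy`) and the existence of an ASYMPTOTIC LATITUDE of every proper end (`latitude_tendsto`): ends of
equilibrium filaments with bounded skeleton velocity are asymptotically CONICAL in position (and their tangents
lie on the cone `ξ² − 2αξη = 1` of `…EndConeLaw`). No stagnation clause is used. No summit statement is proved;
NS regularity is not touched.
-/

noncomputable section

open Set Filter Topology
open Literature.Analysis.FluidPDE Literature.Analysis.FluidPDE.Tao2016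
open scoped RealInnerProductSpace InnerProductSpace

namespace Summit.NavierStokesRegularity.NavierStokesRegularity.Theorems.SkeletonEquilibrium.LengthRegular
set_option linter.dupNamespace false

/-! ## The latitude identity (pointwise, exact) -/

/-- Vertical pairing of the tangency relation: `w⟪T,e₃⟫ = ⟪u,e₃⟫ + ½⟪Ξ,e₃⟫` (the rotation `e₃×Ξ` is
horizontal). [folklore] -/
theorem slip_mul_vertical (α w : ℝ) (u Ξ T : EuclideanSpace ℝ (Fin 3))
    (h : u + (1 / 2 : ℝ) • Ξ - α • cross (EuclideanSpace.single (2 : Fin 3) (1 : ℝ)) Ξ = w • T) :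
    w * ⟪T, EuclideanSpace.single (2 : Fin 3) (1 : ℝ)⟫
      = ⟪u, EuclideanSpace.single (2 : Fin 3) (1 : ℝ)⟫ + 1 / 2 * ⟪Ξ, EuclideanSpace.single (2 : Fin 3) (1 : ℝ)⟫ := by
  have := congrArg (fun v => ⟪v, EuclideanSpace.single (2 : Fin 3) (1 : ℝ)⟫) h
  simp only [inner_add_left, inner_sub_left, real_inner_smul_left, inner_cross_self_left,
    mul_zero, sub_zero] at this
  linarith

/-- **Latitude identity (exact, slip-free).** From `u + ½Ξ − α e₃×Ξ = w T`:
`‖Ξ‖²⟪T,e₃⟫ − ⟪Ξ,e₃⟫⟪T,Ξ⟫ = 2(⟪u,e₃⟫⟪T,Ξ⟫ − ⟪u,Ξ⟫⟪T,e₃⟫)`. [folklore] -/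
theorem latitude_identity (α w : ℝ) (u Ξ T : EuclideanSpace ℝ (Fin 3))
    (h : u + (1 / 2 : ℝ) • Ξ - α • cross (EuclideanSpace.single (2 : Fin 3) (1 : ℝ)) Ξ = w • T) :
    ‖Ξ‖ ^ 2 * ⟪T, EuclideanSpace.single (2 : Fin 3) (1 : ℝ)⟫
        - ⟪Ξ, EuclideanSpace.single (2 : Fin 3) (1 : ℝ)⟫ * ⟪T, Ξ⟫
      = 2 * (⟪u, EuclideanSpace.single (2 : Fin 3) (1 : ℝ)⟫ * ⟪T, Ξ⟫
          - ⟪u, Ξ⟫ * ⟪T, EuclideanSpace.single (2 : Fin 3) (1 : ℝ)⟫) := by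
  have h1 : w * ⟪T, Ξ⟫ = ⟪u, Ξ⟫ + 1 / 2 * ‖Ξ‖ ^ 2 := by
    have := congrArg (fun v => ⟪v, Ξ⟫) h
    simp only [inner_add_left, inner_sub_left, real_inner_smul_left, inner_cross_self_right,
      mul_zero, sub_zero, real_inner_self_eq_norm_sq] at this
    linarith
  have h2 := slip_mul_vertical α w u Ξ T h
  linear_combination 2 * (⟪T, Ξ⟫ * h2 - ⟪T, EuclideanSpace.single (2 : Fin 3) (1 : ℝ)⟫ * h1)

/-- **Latitude bound.** With `‖T‖ = 1` and `‖u‖ ≤ U`: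
`|‖Ξ‖²⟪T,e₃⟫ − ⟪Ξ,e₃⟫⟪T,Ξ⟫| ≤ 4U‖Ξ‖`. [folklore] -/
theorem latitude_bound (α w U : ℝ) (u Ξ T : EuclideanSpace ℝ (Fin 3))
    (h : u + (1 / 2 : ℝ) • Ξ - α • cross (EuclideanSpace.single (2 : Fin 3) (1 : ℝ)) Ξ = w • T)
    (hT : ‖T‖ = 1) (hu : ‖u‖ ≤ U) :
    |‖Ξ‖ ^ 2 * ⟪T, EuclideanSpace.single (2 : Fin 3) (1 : ℝ)⟫
        - ⟪Ξ, EuclideanSpace.single (2 : Fin 3) (1 : ℝ)⟫ * ⟪T, Ξ⟫| ≤ 4 * U * ‖Ξ‖ := by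
  rw [latitude_identity α w u Ξ T h]
  have he : ‖(EuclideanSpace.single (2 : Fin 3) (1 : ℝ))‖ = 1 := by simp
  have hg : 0 ≤ ‖Ξ‖ := norm_nonneg _
  have hU0 : 0 ≤ U := le_trans (norm_nonneg _) hu
  have huz : |⟪u, EuclideanSpace.single (2 : Fin 3) (1 : ℝ)⟫| ≤ U := by
    have := abs_real_inner_le_norm u (EuclideanSpace.single (2 : Fin 3) (1 : ℝ))
    rw [he, mul_one] at this; exact le_trans this hu
  have ha : |⟪T, Ξ⟫| ≤ ‖Ξ‖ := by
    have := abs_real_inner_le_norm T Ξ; rwa [hT, one_mul] at this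
  have hq : |⟪u, Ξ⟫| ≤ U * ‖Ξ‖ :=
    le_trans (abs_real_inner_le_norm u Ξ) (mul_le_mul_of_nonneg_right hu hg)
  have hz : |⟪T, EuclideanSpace.single (2 : Fin 3) (1 : ℝ)⟫| ≤ 1 := by
    have := abs_real_inner_le_norm T (EuclideanSpace.single (2 : Fin 3) (1 : ℝ))
    rwa [hT, he, one_mul] at this
  have h1 : |⟪u, EuclideanSpace.single (2 : Fin 3) (1 : ℝ)⟫ * ⟪T, Ξ⟫| ≤ U * ‖Ξ‖ := by
    rw [abs_mul]; exact mul_le_mul huz ha (abs_nonneg _) hU0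
  have h2 : |⟪u, Ξ⟫ * ⟪T, EuclideanSpace.single (2 : Fin 3) (1 : ℝ)⟫| ≤ U * ‖Ξ‖ * 1 := by
    rw [abs_mul]; exact mul_le_mul hq hz (abs_nonneg _) (by positivity)
  calc |2 * (⟪u, EuclideanSpace.single (2 : Fin 3) (1 : ℝ)⟫ * ⟪T, Ξ⟫
          - ⟪u, Ξ⟫ * ⟪T, EuclideanSpace.single (2 : Fin 3) (1 : ℝ)⟫)|
        = 2 * |⟪u, EuclideanSpace.single (2 : Fin 3) (1 : ℝ)⟫ * ⟪T, Ξ⟫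
          - ⟪u, Ξ⟫ * ⟪T, EuclideanSpace.single (2 : Fin 3) (1 : ℝ)⟫| := by
          rw [abs_mul, abs_of_pos (by norm_num : (0:ℝ) < 2)]
    _ ≤ 2 * (|⟪u, EuclideanSpace.single (2 : Fin 3) (1 : ℝ)⟫ * ⟪T, Ξ⟫|
          + |⟪u, Ξ⟫ * ⟪T, EuclideanSpace.single (2 : Fin 3) (1 : ℝ)⟫|) := by
          gcongr; exact abs_sub _ _
    _ ≤ 2 * (U * ‖Ξ‖ + U * ‖Ξ‖ * 1) := by gcongr
    _ = 4 * U * ‖Ξ‖ := by ring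

/-! ## The latitude along a filament -/

/-- Derivative of the latitude `τ ↦ ⟪Ξ τ, e₃⟫/‖Ξ τ‖` away from the origin. [folklore] -/
theorem hasDerivAt_latitude {Ξ : ℝ → EuclideanSpace ℝ (Fin 3)} (hΞ : Differentiable ℝ Ξ) {τ : ℝ}
    (h0 : Ξ τ ≠ 0) :
    HasDerivAt (fun s => ⟪Ξ s, EuclideanSpace.single (2 : Fin 3) (1 : ℝ)⟫ / ‖Ξ s‖)
      ((⟪deriv Ξ τ, EuclideanSpace.single (2 : Fin 3) (1 : ℝ)⟫ * ‖Ξ τ‖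
        - ⟪Ξ τ, EuclideanSpace.single (2 : Fin 3) (1 : ℝ)⟫ * (⟪Ξ τ, deriv Ξ τ⟫ / ‖Ξ τ‖)) / ‖Ξ τ‖ ^ 2) τ := by
  have h1 : HasDerivAt (fun s => ⟪Ξ s, EuclideanSpace.single (2 : Fin 3) (1 : ℝ)⟫)
      ⟪deriv Ξ τ, EuclideanSpace.single (2 : Fin 3) (1 : ℝ)⟫ τ := by
    have := (hΞ τ).hasDerivAt.inner ℝ (hasDerivAt_const τ (EuclideanSpace.single (2 : Fin 3) (1 : ℝ)))
    rw [inner_zero_right, zero_add] at this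
    exact this
  have h2 := hasDerivAt_norm_curve hΞ h0
  exact h1.div h2 (norm_ne_zero_iff.2 h0)

/-- **Latitude speed bound.** Under the tangency relation with `‖Ξ′‖ = 1`, `‖u‖ ≤ U`, at a parameter with
`Ξ τ ≠ 0`: `|d/dτ (⟪Ξ,e₃⟫/‖Ξ‖)| ≤ 4U/‖Ξ τ‖²`. [folklore] -/
theorem abs_deriv_latitude_le {Ξ u : ℝ → EuclideanSpace ℝ (Fin 3)} {w : ℝ → ℝ} {α U : ℝ}
    (hΞ : Differentiable ℝ Ξ) (hT : ∀ τ, ‖deriv Ξ τ‖ = 1)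
    (heq : ∀ τ, u τ + (1 / 2 : ℝ) • Ξ τ - α • cross (EuclideanSpace.single (2 : Fin 3) (1 : ℝ)) (Ξ τ)
      = w τ • deriv Ξ τ)
    (hu : ∀ τ, ‖u τ‖ ≤ U) {τ : ℝ} (h0 : Ξ τ ≠ 0) :
    |deriv (fun s => ⟪Ξ s, EuclideanSpace.single (2 : Fin 3) (1 : ℝ)⟫ / ‖Ξ s‖) τ| ≤ 4 * U / ‖Ξ τ‖ ^ 2 := by
  rw [(hasDerivAt_latitude hΞ h0).deriv]
  have hg : 0 < ‖Ξ τ‖ := norm_pos_iff.2 h0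
  have key : (⟪deriv Ξ τ, EuclideanSpace.single (2 : Fin 3) (1 : ℝ)⟫ * ‖Ξ τ‖
        - ⟪Ξ τ, EuclideanSpace.single (2 : Fin 3) (1 : ℝ)⟫ * (⟪Ξ τ, deriv Ξ τ⟫ / ‖Ξ τ‖)) / ‖Ξ τ‖ ^ 2
      = (‖Ξ τ‖ ^ 2 * ⟪deriv Ξ τ, EuclideanSpace.single (2 : Fin 3) (1 : ℝ)⟫
          - ⟪Ξ τ, EuclideanSpace.single (2 : Fin 3) (1 : ℝ)⟫ * ⟪deriv Ξ τ, Ξ τ⟫) / ‖Ξ τ‖ ^ 3 := by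
    rw [real_inner_comm (Ξ τ) (deriv Ξ τ)]
    field_simp
  have hb := latitude_bound α (w τ) U (u τ) (Ξ τ) (deriv Ξ τ) (heq τ) (hT τ) (hu τ)
  rw [key, abs_div, abs_of_pos (by positivity : (0:ℝ) < ‖Ξ τ‖ ^ 3),
    div_le_div_iff₀ (by positivity) (by positivity)]
  have := mul_le_mul_of_nonneg_right hb (sq_nonneg ‖Ξ τ‖)
  nlinarith [hg]

/-! ## Monotone envelopes on the right outer branch -/

/-- On the right outer branch the radial derivative is at least `(3 + 4|α|)⁻¹` (sign from
`inner_pos_of_right_branch`, size from `abs_deriv_norm_ge`). [folklore] -/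
theorem deriv_norm_ge_of_right_branch {Ξ u : ℝ → EuclideanSpace ℝ (Fin 3)} {w : ℝ → ℝ} {α U : ℝ}
    (hΞ : Differentiable ℝ Ξ) (hT : ∀ τ, ‖deriv Ξ τ‖ = 1)
    (heq : ∀ τ, u τ + (1 / 2 : ℝ) • Ξ τ - α • cross (EuclideanSpace.single (2 : Fin 3) (1 : ℝ)) (Ξ τ)
      = w τ • deriv Ξ τ)
    (hu : ∀ τ, ‖u τ‖ ≤ U) (htop : Tendsto (fun τ => ‖Ξ τ‖) atTop atTop)
    {s₀ : ℝ} (hs₀ : ‖Ξ s₀‖ ≤ 4 * U) {τ : ℝ} (hτ : s₀ ≤ τ ∧ 4 * U < ‖Ξ τ‖) :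
    (3 + 4 * |α|)⁻¹ ≤ deriv (fun s => ‖Ξ s‖) τ := by
  have hU0 : 0 ≤ U := le_trans (norm_nonneg _) (hu τ)
  have h0 : Ξ τ ≠ 0 := by
    intro h; have := hτ.2; rw [h, norm_zero] at this; linarith
  have hg : 0 < ‖Ξ τ‖ := norm_pos_iff.2 h0
  have hip := inner_pos_of_right_branch hΞ hT heq hu htop hs₀ hτ
  have hab := abs_deriv_norm_ge hΞ hT heq hu hτ.2.le h0
  have hpos : 0 < deriv (fun s => ‖Ξ s‖) τ := by
    rw [(hasDerivAt_norm_curve hΞ h0).deriv, real_inner_comm]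
    exact div_pos hip hg
  rwa [abs_of_pos hpos] at hab

/-- **Upper envelope.** On the right outer branch `R = {τ | s₀ ≤ τ ∧ 4U < ‖Ξ τ‖}` (beyond a point `s₀` of the
velocity ball) the function `⟪Ξ,e₃⟫/‖Ξ‖ + 4U(3+4|α|)/‖Ξ‖` is non-increasing. [folklore] -/
theorem latitude_upper_antitone {Ξ u : ℝ → EuclideanSpace ℝ (Fin 3)} {w : ℝ → ℝ} {α U : ℝ}
    (hΞ : Differentiable ℝ Ξ) (hT : ∀ τ, ‖deriv Ξ τ‖ = 1)
    (heq : ∀ τ, u τ + (1 / 2 : ℝ) • Ξ τ - α • cross (EuclideanSpace.single (2 : Fin 3) (1 : ℝ)) (Ξ τ)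
      = w τ • deriv Ξ τ)
    (hu : ∀ τ, ‖u τ‖ ≤ U) (htop : Tendsto (fun τ => ‖Ξ τ‖) atTop atTop)
    {s₀ : ℝ} (hs₀ : ‖Ξ s₀‖ ≤ 4 * U) :
    AntitoneOn (fun s => ⟪Ξ s, EuclideanSpace.single (2 : Fin 3) (1 : ℝ)⟫ / ‖Ξ s‖
        + 4 * U * (3 + 4 * |α|) * (‖Ξ s‖)⁻¹) {τ | s₀ ≤ τ ∧ 4 * U < ‖Ξ τ‖} := by
  set R : Set ℝ := {τ | s₀ ≤ τ ∧ 4 * U < ‖Ξ τ‖} with hR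
  have hU0 : 0 ≤ U := le_trans (norm_nonneg _) (hu s₀)
  have h0R : ∀ τ ∈ R, Ξ τ ≠ 0 := by
    intro τ hτ h; have := hτ.2; rw [h, norm_zero] at this; linarith
  have hconv : Convex ℝ R := by
    refine Set.OrdConnected.convex ⟨fun a ha b _ c hc => ⟨le_trans ha.1 hc.1, ?_⟩⟩
    exact right_branch_up hΞ hT heq hu hs₀ ha.1 ha.2 hc.1
  -- derivative of the envelope at points of R
  have hder : ∀ τ ∈ R, HasDerivAt (fun s => ⟪Ξ s, EuclideanSpace.single (2 : Fin 3) (1 : ℝ)⟫ / ‖Ξ s‖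
        + 4 * U * (3 + 4 * |α|) * (‖Ξ s‖)⁻¹)
      (deriv (fun s => ⟪Ξ s, EuclideanSpace.single (2 : Fin 3) (1 : ℝ)⟫ / ‖Ξ s‖) τ
        + 4 * U * (3 + 4 * |α|) * (-(⟪Ξ τ, deriv Ξ τ⟫ / ‖Ξ τ‖) / ‖Ξ τ‖ ^ 2)) τ := by
    intro τ hτ
    have h1 := (hasDerivAt_latitude hΞ (h0R τ hτ)).differentiableAt.hasDerivAt
    have h2 := ((hasDerivAt_norm_curve hΞ (h0R τ hτ)).inv (norm_ne_zero_iff.2 (h0R τ hτ))).const_mul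
      (4 * U * (3 + 4 * |α|))
    exact h1.add h2
  have hcont : ContinuousOn (fun s => ⟪Ξ s, EuclideanSpace.single (2 : Fin 3) (1 : ℝ)⟫ / ‖Ξ s‖
      + 4 * U * (3 + 4 * |α|) * (‖Ξ s‖)⁻¹) R :=
    fun τ hτ => (hder τ hτ).continuousAt.continuousWithinAt
  have hdiff : DifferentiableOn ℝ (fun s => ⟪Ξ s, EuclideanSpace.single (2 : Fin 3) (1 : ℝ)⟫ / ‖Ξ s‖
      + 4 * U * (3 + 4 * |α|) * (‖Ξ s‖)⁻¹) (interior R) :=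
    fun τ hτ => (hder τ (interior_subset hτ)).differentiableAt.differentiableWithinAt
  refine antitoneOn_of_deriv_nonpos hconv hcont hdiff ?_
  intro τ hτ
  have hτR : τ ∈ R := interior_subset hτ
  have h0 := h0R τ hτR
  have hg : 0 < ‖Ξ τ‖ := norm_pos_iff.2 h0
  rw [(hder τ hτR).deriv]
  have hlat := abs_deriv_latitude_le hΞ hT heq hu h0
  have hlat' := (abs_le.1 hlat).2
  have hgr := deriv_norm_ge_of_right_branch hΞ hT heq hu htop hs₀ hτR
  rw [(hasDerivAt_norm_curve hΞ h0).deriv] at hgr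
  have hc : 0 < 3 + 4 * |α| := by positivity
  -- 4U/g² - 4U(3+4|α|) g′/g² ≤ 0 since g′ ≥ (3+4|α|)⁻¹
  have h1 : 4 * U * (3 + 4 * |α|) * (-(⟪Ξ τ, deriv Ξ τ⟫ / ‖Ξ τ‖) / ‖Ξ τ‖ ^ 2)
      ≤ -(4 * U / ‖Ξ τ‖ ^ 2) := by
    have h3 : (3 + 4 * |α|) * (⟪Ξ τ, deriv Ξ τ⟫ / ‖Ξ τ‖) ≥ 1 := by
      have := mul_le_mul_of_nonneg_left hgr hc.le
      rwa [mul_inv_cancel₀ (ne_of_gt hc)] at this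
    have h4 : 0 < ‖Ξ τ‖ ^ 2 := by positivity
    rw [show 4 * U * (3 + 4 * |α|) * (-(⟪Ξ τ, deriv Ξ τ⟫ / ‖Ξ τ‖) / ‖Ξ τ‖ ^ 2)
        = -(4 * U * ((3 + 4 * |α|) * (⟪Ξ τ, deriv Ξ τ⟫ / ‖Ξ τ‖)) / ‖Ξ τ‖ ^ 2) by ring]
    rw [neg_le_neg_iff, div_le_div_iff_of_pos_right h4]
    nlinarith
  linarith

/-- **Lower envelope.** On the same branch `⟪Ξ,e₃⟫/‖Ξ‖ − 4U(3+4|α|)/‖Ξ‖` is non-decreasing. [folklore] -/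
theorem latitude_lower_monotone {Ξ u : ℝ → EuclideanSpace ℝ (Fin 3)} {w : ℝ → ℝ} {α U : ℝ}
    (hΞ : Differentiable ℝ Ξ) (hT : ∀ τ, ‖deriv Ξ τ‖ = 1)
    (heq : ∀ τ, u τ + (1 / 2 : ℝ) • Ξ τ - α • cross (EuclideanSpace.single (2 : Fin 3) (1 : ℝ)) (Ξ τ)
      = w τ • deriv Ξ τ)
    (hu : ∀ τ, ‖u τ‖ ≤ U) (htop : Tendsto (fun τ => ‖Ξ τ‖) atTop atTop)
    {s₀ : ℝ} (hs₀ : ‖Ξ s₀‖ ≤ 4 * U) :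
    MonotoneOn (fun s => ⟪Ξ s, EuclideanSpace.single (2 : Fin 3) (1 : ℝ)⟫ / ‖Ξ s‖
        - 4 * U * (3 + 4 * |α|) * (‖Ξ s‖)⁻¹) {τ | s₀ ≤ τ ∧ 4 * U < ‖Ξ τ‖} := by
  set R : Set ℝ := {τ | s₀ ≤ τ ∧ 4 * U < ‖Ξ τ‖} with hR
  have hU0 : 0 ≤ U := le_trans (norm_nonneg _) (hu s₀)
  have h0R : ∀ τ ∈ R, Ξ τ ≠ 0 := by
    intro τ hτ h; have := hτ.2; rw [h, norm_zero] at this; linarith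
  have hconv : Convex ℝ R := by
    refine Set.OrdConnected.convex ⟨fun a ha b _ c hc => ⟨le_trans ha.1 hc.1, ?_⟩⟩
    exact right_branch_up hΞ hT heq hu hs₀ ha.1 ha.2 hc.1
  have hder : ∀ τ ∈ R, HasDerivAt (fun s => ⟪Ξ s, EuclideanSpace.single (2 : Fin 3) (1 : ℝ)⟫ / ‖Ξ s‖
        - 4 * U * (3 + 4 * |α|) * (‖Ξ s‖)⁻¹)
      (deriv (fun s => ⟪Ξ s, EuclideanSpace.single (2 : Fin 3) (1 : ℝ)⟫ / ‖Ξ s‖) τ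
        - 4 * U * (3 + 4 * |α|) * (-(⟪Ξ τ, deriv Ξ τ⟫ / ‖Ξ τ‖) / ‖Ξ τ‖ ^ 2)) τ := by
    intro τ hτ
    have h1 := (hasDerivAt_latitude hΞ (h0R τ hτ)).differentiableAt.hasDerivAt
    have h2 := ((hasDerivAt_norm_curve hΞ (h0R τ hτ)).inv (norm_ne_zero_iff.2 (h0R τ hτ))).const_mul
      (4 * U * (3 + 4 * |α|))
    exact h1.sub h2
  have hcont : ContinuousOn (fun s => ⟪Ξ s, EuclideanSpace.single (2 : Fin 3) (1 : ℝ)⟫ / ‖Ξ s‖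
      - 4 * U * (3 + 4 * |α|) * (‖Ξ s‖)⁻¹) R :=
    fun τ hτ => (hder τ hτ).continuousAt.continuousWithinAt
  have hdiff : DifferentiableOn ℝ (fun s => ⟪Ξ s, EuclideanSpace.single (2 : Fin 3) (1 : ℝ)⟫ / ‖Ξ s‖
      - 4 * U * (3 + 4 * |α|) * (‖Ξ s‖)⁻¹) (interior R) :=
    fun τ hτ => (hder τ (interior_subset hτ)).differentiableAt.differentiableWithinAt
  refine monotoneOn_of_deriv_nonneg hconv hcont hdiff ?_
  intro τ hτ
  have hτR : τ ∈ R := interior_subset hτ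
  have h0 := h0R τ hτR
  have hg : 0 < ‖Ξ τ‖ := norm_pos_iff.2 h0
  rw [(hder τ hτR).deriv]
  have hlat := abs_deriv_latitude_le hΞ hT heq hu h0
  have hlat' := (abs_le.1 hlat).1
  have hgr := deriv_norm_ge_of_right_branch hΞ hT heq hu htop hs₀ hτR
  rw [(hasDerivAt_norm_curve hΞ h0).deriv] at hgr
  have hc : 0 < 3 + 4 * |α| := by positivity
  have h1 : 4 * U / ‖Ξ τ‖ ^ 2
      ≤ -(4 * U * (3 + 4 * |α|) * (-(⟪Ξ τ, deriv Ξ τ⟫ / ‖Ξ τ‖) / ‖Ξ τ‖ ^ 2)) := by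
    have h3 : (3 + 4 * |α|) * (⟪Ξ τ, deriv Ξ τ⟫ / ‖Ξ τ‖) ≥ 1 := by
      have := mul_le_mul_of_nonneg_left hgr hc.le
      rwa [mul_inv_cancel₀ (ne_of_gt hc)] at this
    have h4 : 0 < ‖Ξ τ‖ ^ 2 := by positivity
    rw [show -(4 * U * (3 + 4 * |α|) * (-(⟪Ξ τ, deriv Ξ τ⟫ / ‖Ξ τ‖) / ‖Ξ τ‖ ^ 2))
        = (4 * U * ((3 + 4 * |α|) * (⟪Ξ τ, deriv Ξ τ⟫ / ‖Ξ τ‖))) / ‖Ξ τ‖ ^ 2 by ring]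
    rw [div_le_div_iff_of_pos_right h4]
    nlinarith
  linarith

/-- **Cauchy estimate for the latitude along an end.** For `τ₁ ≤ τ₂` on the right outer branch,
`|⟪Ξ τ₂,e₃⟫/‖Ξ τ₂‖ − ⟪Ξ τ₁,e₃⟫/‖Ξ τ₁‖| ≤ 4U(3+4|α|)·(1/‖Ξ τ₁‖ − 1/‖Ξ τ₂‖) ≤ 4U(3+4|α|)/‖Ξ τ₁‖`. [folklore] -/
theorem latitude_cauchy {Ξ u : ℝ → EuclideanSpace ℝ (Fin 3)} {w : ℝ → ℝ} {α U : ℝ}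
    (hΞ : Differentiable ℝ Ξ) (hT : ∀ τ, ‖deriv Ξ τ‖ = 1)
    (heq : ∀ τ, u τ + (1 / 2 : ℝ) • Ξ τ - α • cross (EuclideanSpace.single (2 : Fin 3) (1 : ℝ)) (Ξ τ)
      = w τ • deriv Ξ τ)
    (hu : ∀ τ, ‖u τ‖ ≤ U) (htop : Tendsto (fun τ => ‖Ξ τ‖) atTop atTop)
    {s₀ : ℝ} (hs₀ : ‖Ξ s₀‖ ≤ 4 * U) {τ₁ τ₂ : ℝ}
    (hτ₁ : s₀ ≤ τ₁ ∧ 4 * U < ‖Ξ τ₁‖) (hτ₂ : s₀ ≤ τ₂ ∧ 4 * U < ‖Ξ τ₂‖) (h12 : τ₁ ≤ τ₂) :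
    |⟪Ξ τ₂, EuclideanSpace.single (2 : Fin 3) (1 : ℝ)⟫ / ‖Ξ τ₂‖
        - ⟪Ξ τ₁, EuclideanSpace.single (2 : Fin 3) (1 : ℝ)⟫ / ‖Ξ τ₁‖|
      ≤ 4 * U * (3 + 4 * |α|) * ((‖Ξ τ₁‖)⁻¹ - (‖Ξ τ₂‖)⁻¹) := by
  have hup := latitude_upper_antitone hΞ hT heq hu htop hs₀ hτ₁ hτ₂ h12
  have hlo := latitude_lower_monotone hΞ hT heq hu htop hs₀ hτ₁ hτ₂ h12
  simp only at hup hlo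
  rw [abs_le]
  constructor <;> linarith

/-- **Every proper end has an asymptotic latitude.** For a unit-speed proper filament with the tangency
relation and `‖u‖ ≤ U` along it, `⟪Ξ τ, e₃⟫/‖Ξ τ‖` converges as `τ → +∞` (and, by `reversal`, as `τ → −∞`):
the ends are asymptotically conical in position. [folklore] -/
theorem latitude_tendsto {Ξ u : ℝ → EuclideanSpace ℝ (Fin 3)} {w : ℝ → ℝ} {α U : ℝ}
    (hΞ : Differentiable ℝ Ξ) (hT : ∀ τ, ‖deriv Ξ τ‖ = 1)
    (heq : ∀ τ, u τ + (1 / 2 : ℝ) • Ξ τ - α • cross (EuclideanSpace.single (2 : Fin 3) (1 : ℝ)) (Ξ τ)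
      = w τ • deriv Ξ τ)
    (hu : ∀ τ, ‖u τ‖ ≤ U) (htop : Tendsto (fun τ => ‖Ξ τ‖) atTop atTop)
    (hbot : Tendsto (fun τ => ‖Ξ τ‖) atBot atTop) :
    ∃ ℓ : ℝ, Tendsto (fun τ => ⟪Ξ τ, EuclideanSpace.single (2 : Fin 3) (1 : ℝ)⟫ / ‖Ξ τ‖) atTop (𝓝 ℓ) := by
  obtain ⟨s₀, hs₀⟩ := exists_norm_le hΞ hT heq hu htop hbot
  have hU0 : 0 ≤ U := le_trans (norm_nonneg _) (hu s₀)
  -- a point τ₁ on the right branch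
  obtain ⟨τ₁, hτ₁g, hτ₁s⟩ : ∃ τ₁, 4 * U < ‖Ξ τ₁‖ ∧ s₀ ≤ τ₁ :=
    ((htop.eventually (eventually_gt_atTop (4 * U))).and (eventually_ge_atTop s₀)).exists
  have hτ₁ : s₀ ≤ τ₁ ∧ 4 * U < ‖Ξ τ₁‖ := ⟨hτ₁s, hτ₁g⟩
  have hR : ∀ τ, τ₁ ≤ τ → (s₀ ≤ τ ∧ 4 * U < ‖Ξ τ‖) := fun τ h =>
    ⟨le_trans hτ₁.1 h, right_branch_up hΞ hT heq hu hs₀ hτ₁.1 hτ₁.2 h⟩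
  set C : ℝ := 4 * U * (3 + 4 * |α|) with hC
  set L : ℝ → ℝ := fun s => ⟪Ξ s, EuclideanSpace.single (2 : Fin 3) (1 : ℝ)⟫ / ‖Ξ s‖
      - C * (‖Ξ s‖)⁻¹ with hL
  have hmono := latitude_lower_monotone hΞ hT heq hu htop hs₀
  -- monotone extension F τ = L (max τ τ₁)
  set F : ℝ → ℝ := fun τ => L (max τ τ₁) with hF
  have hFmono : Monotone F := by
    intro a b hab
    exact hmono (hR _ (le_max_right _ _)) (hR _ (le_max_right _ _)) (max_le_max hab le_rfl)
  have he : ‖(EuclideanSpace.single (2 : Fin 3) (1 : ℝ))‖ = 1 := by simp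
  have hFbdd : BddAbove (range F) := by
    refine ⟨1, ?_⟩
    rintro _ ⟨τ, rfl⟩
    have hτR := hR (max τ τ₁) (le_max_right _ _)
    have hg : 0 < ‖Ξ (max τ τ₁)‖ := by linarith [hτR.2]
    have h1 : ⟪Ξ (max τ τ₁), EuclideanSpace.single (2 : Fin 3) (1 : ℝ)⟫ / ‖Ξ (max τ τ₁)‖ ≤ 1 := by
      rw [div_le_one hg]
      have := abs_real_inner_le_norm (Ξ (max τ τ₁)) (EuclideanSpace.single (2 : Fin 3) (1 : ℝ))
      rw [he, mul_one] at this
      exact le_trans (le_abs_self _) this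
    have h2 : 0 ≤ C * (‖Ξ (max τ τ₁)‖)⁻¹ := by positivity
    show L (max τ τ₁) ≤ 1
    simp only [hL]
    linarith
  have hFlim := tendsto_atTop_ciSup hFmono hFbdd
  set ℓ := ⨆ i, F i with hℓ
  refine ⟨ℓ, ?_⟩
  -- L → ℓ (F agrees with L eventually), C/‖Ξ‖ → 0, so the latitude → ℓ
  have hLlim : Tendsto L atTop (𝓝 ℓ) := by
    refine hFlim.congr' ?_
    filter_upwards [eventually_ge_atTop τ₁] with τ hτ
    simp only [hF, max_eq_left hτ]
  have hinv : Tendsto (fun τ => C * (‖Ξ τ‖)⁻¹) atTop (𝓝 0) := by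
    have := (tendsto_inv_atTop_zero.comp htop).const_mul C
    simpa using this
  have hsum := hLlim.add hinv
  rw [add_zero] at hsum
  refine hsum.congr' ?_
  filter_upwards with τ
  simp only [hL]
  ring

end Summit.NavierStokesRegularity.NavierStokesRegularity.Theorems.SkeletonEquilibrium.LengthRegular
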